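import Mathlib
import HarnessLib

/-!
# Fourier integrals: exponential-sum tails and a model transform (Davis–Rabinowitz 1984, Sect. 3.9)

Davis–Rabinowitz, *Methods of Numerical Integration* (2nd ed., 1984), Sect. 3.9 "The Fourier Transform", pp. 182–184.
For the tail operator `Tf(w) = e^{-iwk} ∫_k^∞ e^{iwx} f(x) dx` (3.9.6), Gustafson and Dahlquist approximate `f` on
`[k, ∞)` by an exponential sum `f_A(x) = Σ_j m_j e^{-x_j x}` (3.9.7); inserting (3.9.7) into (3.9.6) gives the rational
function `Tf_A(w) = Σ_j m_j e^{-x_j k}/(x_j - iw)` (3.9.8).  Recorded: (3.9.8) exactly, for one exponential and for a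
finite exponential sum with positive damping constants `x_j`, on top of Mathlib's `integral_exp_mul_complex_Ioi`; and
the model transform of the first worked example of the rules (3.9.12): `∫_0^∞ e^{-x} e^{iwx} dx = (1 + iw)/(1 + w²)`,
whose imaginary and real parts are `∫_0^∞ e^{-x} sin wx dx = w/(1 + w²)` (the "Exact" row of the table on p. 184) and
`∫_0^∞ e^{-x} cos wx dx = 1/(1 + w²)`.

Provenance: engines group, shared numerical engines serving client cells; rigour lives in the verifiers; every
published number belongs to a client cell's ledger, not to the engines group.  Textbook facts only (no client
numbers).
-/

namespace Literature.Analysis.Quadrature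

open Complex MeasureTheory Set Finset

/-- [folklore] The damping exponent `iw - σ` has real part `-σ`. -/
private theorem re_I_mul_sub (w σ : ℝ) : (I * w - σ : ℂ).re = -σ := by simp

/-- [folklore] `iw - σ ≠ 0` for `σ > 0`. -/
private theorem I_mul_sub_ne_zero (w : ℝ) {σ : ℝ} (hσ : 0 < σ) : (I * w - σ : ℂ) ≠ 0 := by
  intro h
  have := congrArg Complex.re h
  rw [re_I_mul_sub, Complex.zero_re] at this
  linarith

/-- [folklore] `e^{iwx} · m e^{-σx} = m e^{(iw-σ)x}`. -/
private theorem cexp_mul_exp_neg (w σ : ℝ) (m : ℂ) (x : ℝ) :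
    Complex.exp (I * w * x) * (m * Complex.exp (-(σ * x))) = m * Complex.exp ((I * w - σ) * x) := by
  rw [mul_left_comm, ← Complex.exp_add]
  ring_nf

/-- `∫_k^∞ e^{(iw-σ)x} dx = -e^{(iw-σ)k}/(iw - σ)` for `σ > 0` (Mathlib's `integral_exp_mul_complex_Ioi`).
[cite: DavisRabinowitz1984, Sect. 3.9 (3.9.6)-(3.9.8)] -/
theorem integral_Ioi_cexp_I_mul_sub (w : ℝ) {σ : ℝ} (hσ : 0 < σ) (k : ℝ) :
    ∫ x in Ioi k, Complex.exp ((I * w - σ) * x) = -Complex.exp ((I * w - σ) * k) / (I * w - σ) :=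
  integral_exp_mul_complex_Ioi (by rw [re_I_mul_sub]; linarith) k

/-- One exponential `m e^{-σx}`, `σ > 0`, is integrable against `e^{iwx}` on `[k, ∞)` — the convergence half of
the tail formula (3.9.8). [cite: DavisRabinowitz1984, Sect. 3.9 (3.9.8)] -/
theorem integrableOn_cexp_mul_exp_neg (w : ℝ) {σ : ℝ} (hσ : 0 < σ) (m : ℂ) (k : ℝ) :
    IntegrableOn (fun x : ℝ => Complex.exp (I * w * x) * (m * Complex.exp (-(σ * x)))) (Ioi k) := by
  have hi : IntegrableOn (fun x : ℝ => m * Complex.exp ((I * w - σ) * x)) (Ioi k) :=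
    (integrableOn_exp_mul_complex_Ioi (a := I * w - σ) (by rw [re_I_mul_sub]; linarith) k).const_mul m
  exact hi.congr_fun (fun x _ => (cexp_mul_exp_neg w σ m x).symm) measurableSet_Ioi

/-- **(3.9.8), one term**: `e^{-iwk} ∫_k^∞ e^{iwx} · m e^{-σx} dx = m e^{-σk}/(σ - iw)` for `σ > 0`.
[cite: DavisRabinowitz1984, Sect. 3.9 (3.9.8)] -/
theorem fourierTail_exponential (w k : ℝ) {σ : ℝ} (hσ : 0 < σ) (m : ℂ) :
    Complex.exp (-(I * w * k)) * ∫ x in Ioi k, Complex.exp (I * w * x) * (m * Complex.exp (-(σ * x)))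
      = m * (Real.exp (-(σ * k)) : ℂ) / (σ - I * w) := by
  have hint : ∫ x in Ioi k, Complex.exp (I * w * x) * (m * Complex.exp (-(σ * x)))
      = m * ∫ x in Ioi k, Complex.exp ((I * w - σ) * x) := by
    rw [← integral_const_mul]
    exact setIntegral_congr_fun measurableSet_Ioi (fun x _ => cexp_mul_exp_neg w σ m x)
  have e : Complex.exp (-(I * w * k)) * Complex.exp ((I * w - σ) * k) = (Real.exp (-(σ * k)) : ℂ) := by
    rw [← Complex.exp_add, Complex.ofReal_exp]
    congr 1
    push_cast
    ring
  have hne := I_mul_sub_ne_zero w hσ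
  have hne' : (σ - I * w : ℂ) ≠ 0 := by
    rw [show (σ - I * w : ℂ) = -(I * w - σ) by ring]; exact neg_ne_zero.2 hne
  rw [hint, integral_Ioi_cexp_I_mul_sub w hσ k]
  calc Complex.exp (-(I * w * k)) * (m * (-Complex.exp ((I * w - σ) * k) / (I * w - σ)))
      = m * (Complex.exp (-(I * w * k)) * Complex.exp ((I * w - σ) * k)) * (-1 / (I * w - σ)) := by ring
    _ = m * (Real.exp (-(σ * k)) : ℂ) * (-1 / (I * w - σ)) := by rw [e]
    _ = m * (Real.exp (-(σ * k)) : ℂ) / (σ - I * w) := by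
        rw [show (σ - I * w : ℂ) = -(I * w - σ) by ring, div_neg, neg_div]; ring

/-- **(3.9.8)**: for an exponential sum `f_A(x) = Σ_j m_j e^{-x_j x}` with damping constants `x_j > 0`,
`e^{-iwk} ∫_k^∞ e^{iwx} f_A(x) dx = Σ_j m_j e^{-x_j k}/(x_j - iw)` — the tail is a rational function of `w`.
[cite: DavisRabinowitz1984, Sect. 3.9 (3.9.7)-(3.9.8)] -/
theorem fourierTail_expSum {ι : Type*} (s : Finset ι) (m : ι → ℂ) (σ : ι → ℝ) (hσ : ∀ j ∈ s, 0 < σ j)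
    (w k : ℝ) :
    Complex.exp (-(I * w * k)) * ∫ x in Ioi k, Complex.exp (I * w * x) * ∑ j ∈ s, m j * Complex.exp (-(σ j * x))
      = ∑ j ∈ s, m j * (Real.exp (-(σ j * k)) : ℂ) / (σ j - I * w) := by
  simp_rw [Finset.mul_sum]
  rw [integral_finsetSum _ fun j hj => integrableOn_cexp_mul_exp_neg w (hσ j hj) (m j) k, Finset.mul_sum]
  exact Finset.sum_congr rfl fun j hj => fourierTail_exponential w k (hσ j hj) (m j)

/-! ### The model transform `∫_0^∞ e^{-x} e^{iwx} dx` -/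

/-- `∫_0^∞ e^{-x} e^{iwx} dx = (1 + iw)/(1 + w²)`. [cite: DavisRabinowitz1984, Sect. 3.9 (3.9.12)] -/
theorem modelTransform_exp_neg (w : ℝ) :
    ∫ x in Ioi (0:ℝ), Complex.exp ((I * w - 1) * x) = (1 + I * w) / (1 + (w : ℂ) ^ 2) := by
  have h := integral_Ioi_cexp_I_mul_sub w one_pos 0
  push_cast at h
  rw [h]
  simp only [mul_zero, Complex.exp_zero]
  have h1 : (I * w - 1 : ℂ) ≠ 0 := by exact_mod_cast I_mul_sub_ne_zero w one_pos
  have h2 : (1 + (w : ℂ) ^ 2) ≠ 0 := by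
    intro h0
    have := congrArg Complex.re h0
    simp [sq] at this
    nlinarith
  rw [div_eq_div_iff h1 h2]
  ring_nf
  rw [Complex.I_sq]
  ring

/-- The "Exact" row of the first table on p. 184: `∫_0^∞ e^{-x} sin wx dx = w/(1 + w²)`.
[cite: DavisRabinowitz1984, Sect. 3.9 (3.9.12)] -/
theorem sineTransform_exp_neg (w : ℝ) :
    ∫ x in Ioi (0:ℝ), Real.exp (-x) * Real.sin (w * x) = w / (1 + w ^ 2) := by
  have hf : (fun x : ℝ => Real.exp (-x) * Real.sin (w * x)) = fun x : ℝ => (Complex.exp ((I * w - 1) * (x : ℂ))).im := by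
    funext x
    rw [Complex.exp_im]
    simp
  have hint : Integrable (fun x : ℝ => Complex.exp ((I * w - 1) * x)) (volume.restrict (Ioi 0)) :=
    integrableOn_exp_mul_complex_Ioi (a := I * w - 1) (by simp) 0
  rw [hf]
  have := integral_im hint
  simp only [RCLike.im_to_complex] at this
  rw [this, modelTransform_exp_neg]
  have h2 : (1 + (w : ℂ) ^ 2) = ((1 + w ^ 2 : ℝ) : ℂ) := by push_cast; ring
  rw [h2, Complex.div_ofReal_im]
  simp

/-- … and its real part: `∫_0^∞ e^{-x} cos wx dx = 1/(1 + w²)`.  (Problem-side files carry the scaled cosine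
transform `∫_0^∞ e^{-ax} cos ux dx = a/(a² + u²)` under the name `integral_Ioi_exp_neg_mul_cos`, e.g.
`Summits/Ventures/WeilGRH/UniformConductorFloorLorentz.lean`; this is the `a = 1` textbook instance.)
[cite: DavisRabinowitz1984, Sect. 3.9 (3.9.11)] -/
theorem cosineTransform_exp_neg (w : ℝ) :
    ∫ x in Ioi (0:ℝ), Real.exp (-x) * Real.cos (w * x) = 1 / (1 + w ^ 2) := by
  have hf : (fun x : ℝ => Real.exp (-x) * Real.cos (w * x)) = fun x : ℝ => (Complex.exp ((I * w - 1) * (x : ℂ))).re := by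
    funext x
    rw [Complex.exp_re]
    simp
  have hint : Integrable (fun x : ℝ => Complex.exp ((I * w - 1) * x)) (volume.restrict (Ioi 0)) :=
    integrableOn_exp_mul_complex_Ioi (a := I * w - 1) (by simp) 0
  rw [hf]
  have := integral_re hint
  simp only [RCLike.re_to_complex] at this
  rw [this, modelTransform_exp_neg]
  have h2 : (1 + (w : ℂ) ^ 2) = ((1 + w ^ 2 : ℝ) : ℂ) := by push_cast; ring
  rw [h2, Complex.div_ofReal_re]
  simp

end Literature.Analysis.Quadrature
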